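import Literature.MathematicalPhysics.QuantumFieldTheory.Balaban1983to89.Node00.Record10
import Literature.MathematicalPhysics.QuantumFieldTheory.Balaban1983to89.B16NodeKnitRecord9Cor3

/-!
# `Balaban1983to89.B16NodeKnitRecord10` — YM-DAG node N13 · [Balaban1989LargeFieldII] CMP **122** (1989) 355–392, Theorem 1 p. 355 + (0.1), Cor. 3 pp. 387 ∕ 391
# AT NODE 00's STAGE-10 RECORD `Node00.IsRecordOfRecord₁₀C` (`Node00/Record10` p429207, seat node00-def-T: the machine-side successor of `Record9` over the SAME
# `Stage9Params` — β re-pointed to `betaOfRecord₉c` (continuous-version transport `TcOfRecord`, fixed-threshold `chiFixed7`), action side at `…OfRecordT (TcOfRecord …)`,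
# provisos `Provisos₁₀`): modules 14 and 15 of the seat RE-KEYED ₉ ↦ ₁₀ over def-T's names, per-record KEYED forms only (dag-ref-B READ-280)

statement-level bookkeeping over published theorems with citation tags; kernel-checked compositions of tree theorems;
nothing here is a claim about the Yang–Mills mass gap.

CITATION HEADER (lean-in-tree rule).  Source: T. Bałaban, *Large field renormalization. II. Localization, exponentiation, and bounds for the 𝐑 operation*, Commun. Math.
Phys. **122**, 355–392 (1989), doi:10.1007/bf01238433 [Balaban1989LargeFieldII], with [Balaban1988Convergent] (CMP 119: p. 244, (2.17)–(2.18) p. 257, Thm 1 p. 262, Thm 2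
(2.49) p. 264, Cor. 3 (2.50) p. 264).  Seat `pub-ymgap-dag-n13-a` (YM-PLAN Track A, HUMAN RULING D-0062), module 16 of the seat; trigger = `Node00/Record10.lean` ACCEPTED
(def-T LANDED-5).  BY NAME and UNCHANGED: `…Node00.Record10` (`betaOfRecord₁₀`, `gOfRecord₁₀`, `EOfRecord₁₀`, `densOfRecord₁₀`, `tdensOfRecord₁₀`, `SLaw₁₀`, `TLaw₁₀`,
`Stage9Params.toStage5₁₀`, `rOperation_upOfRecord₅C_stage10_iff`, `coreOfRecord₁₀`, `Stage9Params.Provisos₁₀`, `datumOfRecord₁₀`, `datumOfRecord₁₀_C`, `IsRecordOfRecord₁₀C`),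
`…Node00.SmallFieldChiFixedOfRecord` (`chiFixed7`, `chiFixed7_nonneg`, seat def-χ), `…Node00.BackgroundActionOfRecord` (`wilsonBGOfRecord`, `wilsonBGOfRecord_nonneg`),
`…B16NodeKnitRepTowerOfRecord` (module 13: `uvBounds_iff_construction`, `b16_main_at_repTowerOfRecord_along ∕ _dominated`), `…B14NodeKnitRecord9` (seat dag-n11-a:
`b14_main_at_construction_rhoOfRecord9_along` — CONSTRUCTION-GENERIC, so the N11 ∧ N13 junction needs no n11-a ₁₀ file), `…B16NodeKnitRecord9Cor3` (module 15 §0: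
`uvIneq_at_construction_iff`, `uvIneq_at_construction_of_gas` — the Cor.-3 chain's END theorem `B16Cor3CurlyGas.uvIneq_of_repr172_torus_of_ineq249_of_gas` at a construction),
`…DagBinding` (`leavesP`, `WorldP`), `…Dag` (`B14_main` :224, `B16_main` :253, `UVStability4D` :261).

WHY THIS FILE.  At Stage 10 the densities of record keep module 13's shape with re-pointed letters — `densOfRecord₁₀ θ p k = rhoOfRecord9 F N θ.ν θ.τ9 (EOfRecord₁₀ F N θ)
(wOfRecord₉ F N θ) θ.ppSel p (gOfRecord₁₀ F N θ p) k` —, the world's construction is `(coreOfRecord₁₀ F N θ).construction (densOfRecord₁₀ F N θ)` (`datumOfRecord₁₀_C`, `rfl`),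
the core's χ is `chiFixed7 F N θ.ν p.K (gOfRecord₁₀ F N θ p) k` (sign by the THEOREM `chiFixed7_nonneg`) and its §2 clause is `S218` READ AT `densOfRecord₁₀`; the 𝐑-carriers are
pinned from the tower exactly as at ₉ (`rOperation_upOfRecord₅C_stage10_iff`: the leaf IS law transport `TLaw₁₀ k → SLaw₁₀ (k+1)`).  So modules 14 ∕ 15 re-key by `rfl`.
READ-280 (dag-ref-B, vacuity audit A2 ∕ A5) is honoured: only PER-RECORD KEYED forms are stated (the record's own `θ, h` under `D = datumOfRecord₁₀ F N θ h` and the C-binding);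
NO universal-over-θ `_forall_` form — at ₁₀ the laws `S218 ∕ ScorrLaw` are still RESIDUAL (FORMAT FACE №38; their pin is DEDUP №11 ∕ `Record11`), so a universal law slot would
again range over residual-swapped sisters (`BalabanUVNodesN13AtRecord9Keyed` §2 census).

WHAT THIS FILE PROVES (0 `sorry`, 0 `def`, standard axioms).
§1 `rOperation_iff_laws₁₀`; `uvBounds_iff_densOfRecord₁₀`; **`b16_main_at_record₁₀`** (N13 at a ₁₀ world from (R₁₀) + (UV₁₀), NO pin hypothesis); A4 locators
   `laws_of_b16_main_at_record₁₀` ∕ `uvIneq_densOfRecord₁₀_of_b16_main`; **`b16_main_of_isRecordOfRecord₁₀C`** (per-(D, w) keyed).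
§2 **`nodes_N11_N13_at_record₁₀`** (N11 ∧ N13 BY NAME; N11's (𝐑) antecedent := the pin), `uvStability4D_at_record₁₀`, `nodes_N11_N13_of_isRecordOfRecord₁₀C` (keyed).
§3 `b16_main_at_record₁₀_dominated` ((R₁₀) + DOMINATED per-step constants with `B16.UVIneq ((datumOfRecord₁₀ F N θ h).C P) k U E₋ E₊`; `0 ≤ χ` by `chiFixed7_nonneg`).
§4 `uvIneq_at_record₁₀_iff`; **`uvIneq_at_record₁₀_of_gas`** (the Cor.-3 chain's END theorem AT THE STAGE-10 OBJECTS: `hH : R.Holds (densOfRecord₁₀ …)`, `h0χ` vs `chiFixed7`,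
   `h249` vs `(1∕(gOfRecord₁₀ … k)²)·wilsonBGOfRecord …`, counts vs `|Site (F.P P.K) k|`; `hA0` DISCHARGED by `wilsonBGOfRecord_nonneg`).
§5 **`b16_main_at_record₁₀_of_chainLetters`** (N13 at a ₁₀ world from (R₁₀) + (0.1) in the chain's own letters, level-indexed constant families, dominated by `w.em ∕ w.ep`).

HONEST FRAMING.  A count-neutral SLOT landing (R429 (4)(i)): N13 is NOT discharged — (R₁₀) = [Balaban1989LargeFieldII] Thm 1 for 𝐑 and (UV₁₀) = (0.1) ∕ Cor. 3 pointwise, AT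
THE OBJECTS OF RECORD, are displayed HYPOTHESES (or, in §4–§5, the chain's object-level leaves read at `densOfRecord₁₀`); `SLaw₁₀ ∕ TLaw₁₀` are the RESIDUAL format predicates
read at the densities of record; the provisos `Provisos₁₀` (incl. `contT`) are the record's existential clause, not read here; K0 at `N ≥ 2` is OWED (def-T's header).  One
finite four-torus programme at fixed `ε`, Bałaban AS PRINTED with locators; nothing continuum ∕ ℝ⁴ ∕ OS ∕ mass gap ∕ Clay.
-/

noncomputable section

open MeasureTheory
open scoped BigOperators

namespace Literature.MathematicalPhysics.QuantumFieldTheory.Balaban1983to89.B16NodeKnitRecord10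

open DagBinding T4DatumAssembly T4Continuum Node00 FlowStepRuns
open B16NodeKnitRecord5 (b16_main_of_rOperation_of_uvSlot)
open B16NodeKnitRepTowerOfRecord (uvBounds_iff_construction b16_main_at_repTowerOfRecord_along)
open B14NodeKnitRecord9 (b14_main_at_construction_rhoOfRecord9_along)
open B16NodeKnitRecord9Cor3 (uvIneq_at_construction_iff uvIneq_at_construction_of_gas)
open B14Thm2 (Ineq249)
open B16Cor3Ops (Repr172)
open TreeLengthTorus (tsys)
open B13FamilySum (Ineq126 VolBound)
open B16Eq190Resummation (bracket mayerTerm F191 polys190 LocalOps DepOn)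

variable (F : T4Family) (N : ℕ) [NeZero N]

/-! ## §1. N13 at `Stage9Params` over the Stage-10 plugs, and at the Stage-10 record (module 14 §1 re-keyed ₉ ↦ ₁₀) -/

section AtParams

variable (θ : Stage9Params F N) (w : WorldP) (P : B12.RunParams)

/-- **THE 𝐑-LEAF AT STAGE 10 IS LAW TRANSPORT ALONG THE TOWER OF RECORD** (TS-9 (A), node00-def-T's `rOperation_upOfRecord₅C_stage10_iff`): at a run bound by the
C-binding of record over the Stage-10 view, `(leavesP w P).rOperation ↔ ∀ k < P.K, TLaw₁₀ F N θ P k → SLaw₁₀ F N θ P (k+1)` — [Balaban1988Convergent] p. 244's assumed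
property of 𝐑 read at the objects of record («𝐑′𝐓ρ_k, for 𝐓ρ_k in the corresponding space, has the form (2.18) with the §2 conditions» — what [Balaban1989LargeFieldII]
Thm 1 proves). [cite: Balaban1988Convergent, p.244 and remark p.262; Balaban1989LargeFieldII, Thm 1 p.355 (bookkeeping: the leaf unfolded)] -/
theorem rOperation_iff_laws₁₀ (hup : w.up P = upOfRecord₅C F N (θ.toStage5₁₀ F N) P) :
    (leavesP w P).rOperation ↔ ∀ k, k < P.K → TLaw₁₀ F N θ P k → SLaw₁₀ F N θ P (k + 1) := by
  show (w.up P).rOperation ↔ _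
  rw [hup]
  exact rOperation_upOfRecord₅C_stage10_iff F N θ P

variable (h : θ.Provisos₁₀)

/-- **N13's CONCLUSION AT A STAGE-10 WORLD IS (0.1) POINTWISE ON THE DENSITIES OF RECORD**: for `w.C = (datumOfRecord₁₀ F N θ h).C`, `(leavesP w P).uvBounds` IS «for
every `k ≤ K` and every gauge field `U` on `T^{(k)}`: `χ_k(U)·exp[−A^η_k(U)∕g_k² − e₋(g_k)·|T₁^{(k)}|] ≤ ρ_k(U) ≤ exp[e₊(g_k)·|T₁^{(k)}|]`» with `χ_k = chiFixed7 F N θ.ν P.K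
(gOfRecord₁₀ θ P) k` (def-χ's fixed threshold), `A^η_k = wilsonBGOfRecord F N θ.εbg P k`, `g_k = gOfRecord₁₀ F N θ P k`, `ρ_k = densOfRecord₁₀ F N θ P k` (= `rhoOfRecord9 …` = `eval rep_k`, EXPLICIT) and the world's
dependence functions `e₋ = w.em`, `e₊ = w.ep` (`rfl` through `datumOfRecord₁₀_C` and module 13's `uvBounds_iff_construction`).
[cite: Balaban1989LargeFieldII, (0.1) pp.355–356; Balaban1988Convergent, (2.18) p.257, Cor. 3 (2.50) p.264] -/
theorem uvBounds_iff_densOfRecord₁₀ (hC : w.C = (datumOfRecord₁₀ F N θ h).C) :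
    (leavesP w P).uvBounds ↔
      ∀ k, k ≤ P.K → ∀ U : GaugeField (F.P P.K) k (SU N),
        chiFixed7 F N θ.ν P.K (gOfRecord₁₀ F N θ P) k U *
              Real.exp (-(1 / (gOfRecord₁₀ F N θ P k) ^ 2 * wilsonBGOfRecord F N θ.εbg P k U)
                - w.em (gOfRecord₁₀ F N θ P k) * (Fintype.card (Site (F.P P.K) k) : ℝ)) ≤ densOfRecord₁₀ F N θ P k U ∧
        densOfRecord₁₀ F N θ P k U ≤ Real.exp (w.ep (gOfRecord₁₀ F N θ P k) * (Fintype.card (Site (F.P P.K) k) : ℝ)) :=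
  uvBounds_iff_construction F N (coreOfRecord₁₀ F N θ) (densOfRecord₁₀ F N θ) w P (hC.trans (datumOfRecord₁₀_C F N θ h))

/-- **N13 AT A STAGE-10 WORLD** ([Balaban1989LargeFieldII] Thm 1 p. 355 + (0.1), Cor. 3 pp. 387 ∕ 391, AT NODE 00's REPRESENTED TOWER OF RECORD): for `w.C =
(datumOfRecord₁₀ F N θ h).C` and `w.up P = upOfRecord₅C F N (θ.toStage5₁₀ F N) P`, `Dag.B16_main (leavesP w P)` from N13's two OWN products at the objects of record — **(R₁₀)**
`hR9 : ∀ k < P.K, TLaw₁₀ F N θ P k → SLaw₁₀ F N θ P (k+1)` (𝐑 transports the corresponding space of `𝐓ρ_k` into the §2 format of `ρ_{k+1}`; IS the leaf, §1 — NO pin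
hypothesis) and **(UV₁₀)** `hUV9` ((0.1) pointwise on `densOfRecord₁₀ … k` for §2-format levels `SLaw₁₀ … k`, below `γ₁ ≥ w.γ`; p. 387).  Module 13's
`b16_main_at_repTowerOfRecord_along` at `M := coreOfRecord₁₀ F N θ`, `Laws k _ := SLaw₁₀ … k`, `LawsT k _ := TLaw₁₀ … k`, `hS9 := Iff.rfl`.  HYPOTHESES displayed; count-neutral.
[cite: Balaban1989LargeFieldII, Thm 1 p.355, (0.1) pp.355–356, p.387, p.391; Balaban1988Convergent, p.244, (2.18) p.257, Cor. 3 p.264] -/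
theorem b16_main_at_record₁₀ (hC : w.C = (datumOfRecord₁₀ F N θ h).C) (hup : w.up P = upOfRecord₅C F N (θ.toStage5₁₀ F N) P)
    (hR9 : ∀ k, k < P.K → TLaw₁₀ F N θ P k → SLaw₁₀ F N θ P (k + 1)) {γ₁ : ℝ} (hγ : w.γ ≤ γ₁)
    (hUV9 : (genFlow (betaOfRecord₁₀ F N θ) P.g0).InInterval γ₁ P.K → ∀ k, k ≤ P.K → SLaw₁₀ F N θ P k →
      ∀ U : GaugeField (F.P P.K) k (SU N),
        chiFixed7 F N θ.ν P.K (gOfRecord₁₀ F N θ P) k U *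
              Real.exp (-(1 / (gOfRecord₁₀ F N θ P k) ^ 2 * wilsonBGOfRecord F N θ.εbg P k U)
                - w.em (gOfRecord₁₀ F N θ P k) * (Fintype.card (Site (F.P P.K) k) : ℝ)) ≤ densOfRecord₁₀ F N θ P k U ∧
        densOfRecord₁₀ F N θ P k U ≤ Real.exp (w.ep (gOfRecord₁₀ F N θ P k) * (Fintype.card (Site (F.P P.K) k) : ℝ))) :
    Dag.B16_main (leavesP w P) :=
  b16_main_at_repTowerOfRecord_along F N (coreOfRecord₁₀ F N θ) w P θ.ν θ.τ9 (EOfRecord₁₀ F N θ) (wOfRecord₉ F N θ) θ.ppSel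
    (gOfRecord₁₀ F N θ) (fun k _ => SLaw₁₀ F N θ P k) (fun k _ => TLaw₁₀ F N θ P k) (hC.trans (datumOfRecord₁₀_C F N θ h))
    (fun _ _ => Iff.rfl) (rOperation_iff_laws₁₀ F N θ w P hup).2 hR9 hγ hUV9

/-- **What N13's 𝐑-product SAYS at Stage 10** (A4 locator): N13 at a Stage-10-bound run, with its in-edge leaves and the small-field implication, YIELDS law transport
along the tower of record — `∀ k < P.K, TLaw₁₀ F N θ P k → SLaw₁₀ F N θ P (k+1)` (content exactly that of the residual laws `ScorrLaw`∕`S218`: RIDER №38).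
[cite: Balaban1989LargeFieldII, Thm 1 p.355 (bookkeeping); Balaban1988Convergent, p.244] -/
theorem laws_of_b16_main_at_record₁₀ (hup : w.up P = upOfRecord₅C F N (θ.toStage5₁₀ F N) P) (hN : Dag.B16_main (leavesP w P))
    (h5 : (leavesP w P).b5) (h6 : (leavesP w P).b6) (h7 : (leavesP w P).b7) (h9 : (leavesP w P).b9) (h10 : (leavesP w P).b10)
    (h11 : (leavesP w P).b11) (h13 : (leavesP w P).b13) (hrb : (leavesP w P).rBasicStep)
    (hsf : (leavesP w P).smallCouplings → (leavesP w P).smallFieldInductive) :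
    ∀ k, k < P.K → TLaw₁₀ F N θ P k → SLaw₁₀ F N θ P (k + 1) :=
  (rOperation_iff_laws₁₀ F N θ w P hup).1 (hN h5 h6 h7 h9 h10 h11 h13 hrb hsf).1

/-- **What N13's Cor.-3 product SAYS at Stage 10** (A4 locator): N13 at a ₁₀ world with its in-edge leaves, the interval hypothesis on `]0, w.γ]` for the generated flow
and §2-format levels `∀ k ≤ K, SLaw₁₀ F N θ P k` YIELDS (0.1) POINTWISE ON `densOfRecord₁₀ F N θ P k`, every `k ≤ K`, every configuration.
[cite: Balaban1989LargeFieldII, (0.1) pp.355–356 (bookkeeping); Balaban1988Convergent, (2.18) p.257] -/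
theorem uvIneq_densOfRecord₁₀_of_b16_main (hC : w.C = (datumOfRecord₁₀ F N θ h).C) (hN : Dag.B16_main (leavesP w P))
    (h5 : (leavesP w P).b5) (h6 : (leavesP w P).b6) (h7 : (leavesP w P).b7) (h9 : (leavesP w P).b9) (h10 : (leavesP w P).b10)
    (h11 : (leavesP w P).b11) (h13 : (leavesP w P).b13) (hrb : (leavesP w P).rBasicStep)
    (hsf : (leavesP w P).smallCouplings → (leavesP w P).smallFieldInductive)
    (hsc : (genFlow (betaOfRecord₁₀ F N θ) P.g0).InInterval w.γ P.K) (hlaws : ∀ k, k ≤ P.K → SLaw₁₀ F N θ P k)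
    (k : ℕ) (hk : k ≤ P.K) (U : GaugeField (F.P P.K) k (SU N)) :
    chiFixed7 F N θ.ν P.K (gOfRecord₁₀ F N θ P) k U *
          Real.exp (-(1 / (gOfRecord₁₀ F N θ P k) ^ 2 * wilsonBGOfRecord F N θ.εbg P k U)
            - w.em (gOfRecord₁₀ F N θ P k) * (Fintype.card (Site (F.P P.K) k) : ℝ)) ≤ densOfRecord₁₀ F N θ P k U ∧
      densOfRecord₁₀ F N θ P k U ≤ Real.exp (w.ep (gOfRecord₁₀ F N θ P k) * (Fintype.card (Site (F.P P.K) k) : ℝ)) := by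
  have hC' : w.C = (coreOfRecord₁₀ F N θ).construction (densOfRecord₁₀ F N θ) := hC.trans (datumOfRecord₁₀_C F N θ h)
  have hdd : (leavesP w P).smallCouplings → (leavesP w P).densitiesDescribed := by
    intro _
    change ∀ k, k ≤ P.K → (w.C P).Sect2Form k
    rw [hC']
    exact hlaws
  have hsc' : (leavesP w P).smallCouplings := by
    change (w.C P).flow.InInterval w.γ P.K
    rw [hC']
    exact hsc
  have huv : (leavesP w P).uvBounds := (hN h5 h6 h7 h9 h10 h11 h13 hrb hsf).2 hdd hsc'
  exact (uvBounds_iff_densOfRecord₁₀ F N θ w P h hC).1 huv k hk U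

end AtParams

section AtRecord

variable {F N} {D : FiniteEpsData F (SU N)} {w : WorldP}

/-- **N13 AT NODE 00's STAGE-10 RECORD `IsRecordOfRecord₁₀C`** — from the per-parameter products at the objects of record: for the record's admissible `θ` with
provisos `h` (`D = datumOfRecord₁₀ F N θ h`, runs bound over `θ.toStage5₁₀ F N`), (R₁₀) law transport by 𝐑 along the tower at every run and (UV₁₀) (0.1) pointwise on
`densOfRecord₁₀` for §2-format levels below `w.γ`. [cite: Balaban1989LargeFieldII, Thm 1 p.355, (0.1) pp.355–356, p.387, p.391; Balaban1988Convergent, p.244, Cor. 3 p.264] -/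
theorem b16_main_of_isRecordOfRecord₁₀C (hrec : IsRecordOfRecord₁₀C F N D w)
    (slots : ∀ (θ : Stage9Params F N) (h : θ.Provisos₁₀), θ.Admissible → D = datumOfRecord₁₀ F N θ h →
      (∀ P, w.up P = upOfRecord₅C F N (θ.toStage5₁₀ F N) P) → ∀ P : B12.RunParams,
        (∀ k, k < P.K → TLaw₁₀ F N θ P k → SLaw₁₀ F N θ P (k + 1)) ∧
        ((genFlow (betaOfRecord₁₀ F N θ) P.g0).InInterval w.γ P.K → ∀ k, k ≤ P.K → SLaw₁₀ F N θ P k →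
          ∀ U : GaugeField (F.P P.K) k (SU N),
            chiFixed7 F N θ.ν P.K (gOfRecord₁₀ F N θ P) k U *
                  Real.exp (-(1 / (gOfRecord₁₀ F N θ P k) ^ 2 * wilsonBGOfRecord F N θ.εbg P k U)
                    - w.em (gOfRecord₁₀ F N θ P k) * (Fintype.card (Site (F.P P.K) k) : ℝ)) ≤ densOfRecord₁₀ F N θ P k U ∧
            densOfRecord₁₀ F N θ P k U ≤ Real.exp (w.ep (gOfRecord₁₀ F N θ P k) * (Fintype.card (Site (F.P P.K) k) : ℝ)))) :
    ∀ P : B12.RunParams, Dag.B16_main (leavesP w P) := by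
  intro P
  obtain ⟨θ, h, hθ, hD, hC, -, -, hup⟩ := hrec
  obtain ⟨hR9, hUV9⟩ := slots θ h hθ hD hup P
  exact b16_main_at_record₁₀ F N θ w P h (by rw [hC, hD]) (hup P) hR9 le_rfl hUV9

end AtRecord

/-! ## §2. N11 ∧ N13 at Stage 10, BY NAME — N11's (𝐑) antecedent DISCHARGED BY THE PIN (module 14 §2 re-keyed; n11-a's construction-generic theorem) -/

section Junction

variable (θ : Stage9Params F N) (h : θ.Provisos₁₀) (w : WorldP) (P : B12.RunParams)

/-- **N11 ∧ N13 AT A STAGE-10 WORLD, BY NAME** (seat dag-n11-a's `B14NodeKnitRecord9.b14_main_at_construction_rhoOfRecord9_along` + `b16_main_at_record₁₀`): at `w.C =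
(datumOfRecord₁₀ F N θ h).C`, `w.up P = upOfRecord₅C F N (θ.toStage5₁₀ F N) P`, from — (S0) `h0`: under the interval hypothesis the Wilson start `ρ₀` of record has the §2
format (`SLaw₁₀ … 0`); (S1ᵀ) `hT`: THE THEOREM OF [Balaban1988Convergent] p. 245 at the objects of record — given N11's antecedents, a §2-format `ρ_k` of record has
its T-image `𝐓ρ_k` of record in the corresponding space (`SLaw₁₀ … k → TLaw₁₀ … k`), `k < K`; (R₁₀) `hR9`: [Balaban1989LargeFieldII] Thm 1 at the objects of record
(`TLaw₁₀ … k → SLaw₁₀ … (k+1)`); (UV₁₀) `hUV9`: (0.1) pointwise on `densOfRecord₁₀`.  N11's (𝐑) antecedent `rOperation → (law transport)` is the PIN (`(rOperation_iff_laws₁₀ …).1`),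
so it is NOT a hypothesis here. [cite: Balaban1988Convergent, Thm 1 p.262, Theorem p.245, p.244; Balaban1989LargeFieldII, Thm 1 p.355, (0.1) pp.355–356, p.387, p.391] -/
theorem nodes_N11_N13_at_record₁₀ (hC : w.C = (datumOfRecord₁₀ F N θ h).C) (hup : w.up P = upOfRecord₅C F N (θ.toStage5₁₀ F N) P)
    (h0 : (leavesP w P).smallCouplings → SLaw₁₀ F N θ P 0)
    (hT : (leavesP w P).b7 → (leavesP w P).b8 → (leavesP w P).b9 → (leavesP w P).b10 → (leavesP w P).b11 →
      (leavesP w P).smallCouplings → (leavesP w P).smallFieldInductive → (leavesP w P).flowControl →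
        ∀ k, k < P.K → SLaw₁₀ F N θ P k → TLaw₁₀ F N θ P k)
    (hR9 : ∀ k, k < P.K → TLaw₁₀ F N θ P k → SLaw₁₀ F N θ P (k + 1)) {γ₁ : ℝ} (hγ : w.γ ≤ γ₁)
    (hUV9 : (genFlow (betaOfRecord₁₀ F N θ) P.g0).InInterval γ₁ P.K → ∀ k, k ≤ P.K → SLaw₁₀ F N θ P k →
      ∀ U : GaugeField (F.P P.K) k (SU N),
        chiFixed7 F N θ.ν P.K (gOfRecord₁₀ F N θ P) k U *
              Real.exp (-(1 / (gOfRecord₁₀ F N θ P k) ^ 2 * wilsonBGOfRecord F N θ.εbg P k U)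
                - w.em (gOfRecord₁₀ F N θ P k) * (Fintype.card (Site (F.P P.K) k) : ℝ)) ≤ densOfRecord₁₀ F N θ P k U ∧
        densOfRecord₁₀ F N θ P k U ≤ Real.exp (w.ep (gOfRecord₁₀ F N θ P k) * (Fintype.card (Site (F.P P.K) k) : ℝ))) :
    Dag.B14_main (leavesP w P) ∧ Dag.B16_main (leavesP w P) :=
  ⟨b14_main_at_construction_rhoOfRecord9_along F N (coreOfRecord₁₀ F N θ) w P θ.ν θ.τ9 (EOfRecord₁₀ F N θ) (wOfRecord₉ F N θ) θ.ppSel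
      (gOfRecord₁₀ F N θ) (fun p k _ => SLaw₁₀ F N θ p k) (fun p k _ => TLaw₁₀ F N θ p k) (hC.trans (datumOfRecord₁₀_C F N θ h))
      (fun _ _ => Iff.rfl) h0 hT (fun hrop => (rOperation_iff_laws₁₀ F N θ w P hup).1 hrop),
    b16_main_at_record₁₀ F N θ w P h hC hup hR9 hγ hUV9⟩

/-- **The run's (B) `Dag.UVStability4D (leavesP w P)` AT A STAGE-10 WORLD** («interval ⇒ §2 description ∧ (0.1)»): the slots of `nodes_N11_N13_at_record₁₀`, GIVEN — as
hypotheses — N11's in-edge leaves `b7 … b11`, N13's `b5, b6, b13, rBasicStep`, the small-field leaf and the located flow step.  Pure composition.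
[cite: Balaban1989LargeFieldII, Thm 1 + (0.1) p.355; Balaban1988Convergent, Thm 1 p.262] -/
theorem uvStability4D_at_record₁₀ (hC : w.C = (datumOfRecord₁₀ F N θ h).C) (hup : w.up P = upOfRecord₅C F N (θ.toStage5₁₀ F N) P)
    (h0 : (leavesP w P).smallCouplings → SLaw₁₀ F N θ P 0)
    (hT : (leavesP w P).b7 → (leavesP w P).b8 → (leavesP w P).b9 → (leavesP w P).b10 → (leavesP w P).b11 →
      (leavesP w P).smallCouplings → (leavesP w P).smallFieldInductive → (leavesP w P).flowControl →
        ∀ k, k < P.K → SLaw₁₀ F N θ P k → TLaw₁₀ F N θ P k)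
    (hR9 : ∀ k, k < P.K → TLaw₁₀ F N θ P k → SLaw₁₀ F N θ P (k + 1)) {γ₁ : ℝ} (hγ : w.γ ≤ γ₁)
    (hUV9 : (genFlow (betaOfRecord₁₀ F N θ) P.g0).InInterval γ₁ P.K → ∀ k, k ≤ P.K → SLaw₁₀ F N θ P k →
      ∀ U : GaugeField (F.P P.K) k (SU N),
        chiFixed7 F N θ.ν P.K (gOfRecord₁₀ F N θ P) k U *
              Real.exp (-(1 / (gOfRecord₁₀ F N θ P k) ^ 2 * wilsonBGOfRecord F N θ.εbg P k U)
                - w.em (gOfRecord₁₀ F N θ P k) * (Fintype.card (Site (F.P P.K) k) : ℝ)) ≤ densOfRecord₁₀ F N θ P k U ∧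
        densOfRecord₁₀ F N θ P k U ≤ Real.exp (w.ep (gOfRecord₁₀ F N θ P k) * (Fintype.card (Site (F.P P.K) k) : ℝ)))
    (h5 : (leavesP w P).b5) (h6 : (leavesP w P).b6) (h7 : (leavesP w P).b7) (h8 : (leavesP w P).b8) (h9 : (leavesP w P).b9)
    (h10 : (leavesP w P).b10) (h11 : (leavesP w P).b11) (h13 : (leavesP w P).b13) (hrb : (leavesP w P).rBasicStep)
    (hsf : (leavesP w P).smallCouplings → (leavesP w P).smallFieldInductive)
    (hfc : (leavesP w P).smallCouplings → (leavesP w P).flowControl) :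
    Dag.UVStability4D (leavesP w P) := by
  obtain ⟨h14, h16⟩ := nodes_N11_N13_at_record₁₀ F N θ h w P hC hup h0 hT hR9 hγ hUV9
  obtain ⟨hrop, huv⟩ := h16 h5 h6 h7 h9 h10 h11 h13 hrb hsf
  have hdd : (leavesP w P).smallCouplings → (leavesP w P).densitiesDescribed := h14 h7 h8 h9 h10 h11 hsf hfc hrop
  exact fun hsc => ⟨hdd hsc, huv hdd hsc⟩

variable {F N} {D : FiniteEpsData F (SU N)}

/-- **N11 ∧ N13 at every run of a Stage-10 record** from the per-parameter slots (S0), (S1ᵀ), (R₁₀), (UV₁₀) at the objects of record — the K2 «FlowBounds» conjuncts 5–6 at ₁₀C.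
[cite: Balaban1988Convergent, Thm 1 p.262, Theorem p.245; Balaban1989LargeFieldII, Thm 1 p.355, (0.1) pp.355–356, p.387, p.391] -/
theorem nodes_N11_N13_of_isRecordOfRecord₁₀C {w : WorldP} (hrec : IsRecordOfRecord₁₀C F N D w)
    (slots : ∀ (θ : Stage9Params F N) (h : θ.Provisos₁₀), θ.Admissible → D = datumOfRecord₁₀ F N θ h →
      (∀ P, w.up P = upOfRecord₅C F N (θ.toStage5₁₀ F N) P) → ∀ P : B12.RunParams,
        ((leavesP w P).smallCouplings → SLaw₁₀ F N θ P 0) ∧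
        ((leavesP w P).b7 → (leavesP w P).b8 → (leavesP w P).b9 → (leavesP w P).b10 → (leavesP w P).b11 →
          (leavesP w P).smallCouplings → (leavesP w P).smallFieldInductive → (leavesP w P).flowControl →
            ∀ k, k < P.K → SLaw₁₀ F N θ P k → TLaw₁₀ F N θ P k) ∧
        (∀ k, k < P.K → TLaw₁₀ F N θ P k → SLaw₁₀ F N θ P (k + 1)) ∧
        ((genFlow (betaOfRecord₁₀ F N θ) P.g0).InInterval w.γ P.K → ∀ k, k ≤ P.K → SLaw₁₀ F N θ P k →
          ∀ U : GaugeField (F.P P.K) k (SU N),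
            chiFixed7 F N θ.ν P.K (gOfRecord₁₀ F N θ P) k U *
                  Real.exp (-(1 / (gOfRecord₁₀ F N θ P k) ^ 2 * wilsonBGOfRecord F N θ.εbg P k U)
                    - w.em (gOfRecord₁₀ F N θ P k) * (Fintype.card (Site (F.P P.K) k) : ℝ)) ≤ densOfRecord₁₀ F N θ P k U ∧
            densOfRecord₁₀ F N θ P k U ≤ Real.exp (w.ep (gOfRecord₁₀ F N θ P k) * (Fintype.card (Site (F.P P.K) k) : ℝ)))) :
    ∀ P : B12.RunParams, Dag.B14_main (leavesP w P) ∧ Dag.B16_main (leavesP w P) := by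
  intro P
  obtain ⟨θ, h, hθ, hD, hC, -, -, hup⟩ := hrec
  obtain ⟨h0, hT, hR9, hUV9⟩ := slots θ h hθ hD hup P
  exact nodes_N11_N13_at_record₁₀ F N θ h w P (by rw [hC, hD]) (hup P) h0 hT hR9 le_rfl hUV9

end Junction

/-! ## §3. N13 at Stage 10 from the Cor.-3 chain's DOMINATED constants (module 14 §3 re-keyed; `0 ≤ χ` by `chiFixed7_nonneg`) -/

section Dominated

variable (θ : Stage9Params F N) (w : WorldP) (P : B12.RunParams) (h : θ.Provisos₁₀)

/-- **N13 AT A STAGE-10 WORLD from (R₁₀) and DOMINATED per-step (0.1) constants** — the currency the cell's Cor.-3 chain delivers at the construction of record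
(`B16Cor3CurlyGas.uvIneq_of_repr172_torus_of_ineq249_of_gas` ∕ `B16Cor3ActionBounds` at `D := (datumOfRecord₁₀ F N θ h).C P`: a `Repr172` representation of `ρ_k` of record ⇒
`B16.UVIneq D k U E₋ E₊` pointwise): below the threshold every §2-format level admits `E₋ ≤ w.em(g_k)`, `E₊ ≤ w.ep(g_k)` with `B16.UVIneq ((datumOfRecord₁₀ F N θ h).C P) k U E₋ E₊`
for every `U` (`hUVd`); the sign convention `0 ≤ χ_k` is a THEOREM of record (`Node00.chiFixed7_nonneg`), not a hypothesis.  Module 13's `b16_main_at_repTowerOfRecord_dominated`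
(v1.1). [cite: Balaban1989LargeFieldII, Thm 1 p.355, (0.1) pp.355–356 («E₋, E₊ independent of k, T_η, U_k»), p.387; Balaban1988Convergent, (2.17) p.257] -/
theorem b16_main_at_record₁₀_dominated (hC : w.C = (datumOfRecord₁₀ F N θ h).C) (hup : w.up P = upOfRecord₅C F N (θ.toStage5₁₀ F N) P)
    (hR9 : ∀ k, k < P.K → TLaw₁₀ F N θ P k → SLaw₁₀ F N θ P (k + 1)) {γ₁ : ℝ} (hγ : w.γ ≤ γ₁)
    (hUVd : (genFlow (betaOfRecord₁₀ F N θ) P.g0).InInterval γ₁ P.K → ∀ k, k ≤ P.K → SLaw₁₀ F N θ P k →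
      ∃ Em Ep : ℝ, Em ≤ w.em (gOfRecord₁₀ F N θ P k) ∧ Ep ≤ w.ep (gOfRecord₁₀ F N θ P k) ∧
        ∀ U : GaugeField (F.P P.K) k (SU N), B16.UVIneq ((datumOfRecord₁₀ F N θ h).C P) k U Em Ep) :
    Dag.B16_main (leavesP w P) :=
  B16NodeKnitRepTowerOfRecord.b16_main_at_repTowerOfRecord_dominated F N (coreOfRecord₁₀ F N θ) w P θ.ν θ.τ9 (EOfRecord₁₀ F N θ)
    (wOfRecord₉ F N θ) θ.ppSel (gOfRecord₁₀ F N θ) (fun k _ => SLaw₁₀ F N θ P k) (fun k _ => TLaw₁₀ F N θ P k)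
    (hC.trans (datumOfRecord₁₀_C F N θ h)) (fun _ _ hs => hs) (rOperation_iff_laws₁₀ F N θ w P hup).2 (fun k hk _ hT => hR9 k hk hT) hγ
    (fun k _ U => chiFixed7_nonneg F N θ.ν P.K (gOfRecord₁₀ F N θ P) k U) hUVd

end Dominated

/-! ## §4. The Cor.-3 chain's END theorem AT THE OBJECTS OF RECORD (Stage 10) — module 15 §1 re-keyed -/

section ChainAtRecord

variable (θ : Stage9Params F N) (h : θ.Provisos₁₀) (P : B12.RunParams) (k : ℕ)

/-- **(0.1) ∕ (2.50) AT THE CONSTRUCTION OF RECORD, unfolded** (`rfl` through `datumOfRecord₁₀_C` and `RGMachineCore.construction`): at `D := (datumOfRecord₁₀ F N θ h).C P`,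
`B16.UVIneq D k V Em Ep` IS «`χ_k(V)·exp[−(1∕g_k²)A^η_k(V) − Em·|T₁^{(k)}|] ≤ ρ_k(V)` ∧ `ρ_k(V) ≤ exp(Ep·|T₁^{(k)}|)`» with `χ_k = chiFixed7 F N θ.ν P.K (gOfRecord₁₀ F N θ P) k`,
`A^η_k = wilsonBGOfRecord F N θ.εbg P k`, `g_k = gOfRecord₁₀ F N θ P k`, `ρ_k = densOfRecord₁₀ F N θ P k` (EXPLICIT, `= eval rep_k`), `|T₁^{(k)}| = |Site (F.P P.K) k|`.
[cite: Balaban1989LargeFieldII, (0.1) pp.355–356; Balaban1988Convergent, (2.17)–(2.18) p.257, (2.50) p.264 (bookkeeping)] -/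
theorem uvIneq_at_record₁₀_iff (V : GaugeField (F.P P.K) k (SU N)) (Em Ep : ℝ) :
    B16.UVIneq ((datumOfRecord₁₀ F N θ h).C P) k V Em Ep ↔
      chiFixed7 F N θ.ν P.K (gOfRecord₁₀ F N θ P) k V *
            Real.exp (-(1 / (gOfRecord₁₀ F N θ P k) ^ 2 * wilsonBGOfRecord F N θ.εbg P k V) - Em * (Fintype.card (Site (F.P P.K) k) : ℝ)) ≤
          densOfRecord₁₀ F N θ P k V ∧
        densOfRecord₁₀ F N θ P k V ≤ Real.exp (Ep * (Fintype.card (Site (F.P P.K) k) : ℝ)) :=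
  uvIneq_at_construction_iff F N (coreOfRecord₁₀ F N θ) (densOfRecord₁₀ F N θ) P k V Em Ep

/-- **THE COR.-3 CHAIN'S END THEOREM AT THE OBJECTS OF RECORD** — the ₉ junction of `B16Cor3CurlyGas.uvIneq_of_repr172_torus_of_ineq249_of_gas` to `densOfRecord₁₀`: one run `P`, one
level `k`, at `D := (datumOfRecord₁₀ F N θ h).C P`.  BINDERS = the chain's, READ AT THE RECORD: a (1.72) representation `R` of `ρ_k` OF RECORD on the torus cube catalogue
(`hH : R.Holds (densOfRecord₁₀ F N θ P k)` — [Balaban1989LargeFieldII] Thm 1's own output «𝐑ρ_k can be written in the form …», p. 390), its χ-dictionary against `chiFixed7`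
(`hχ01`, `h0χ`), the site count `|T₁^{(k)}| = (M₁·Nc)⁴` (`hnum`), the factor leaves (1.79)∕(1.89) per component (`hZ`, `hY`), the (1.90) gas of every admissible term at the
configurations `cfg : GaugeField (F.P P.K) k (SU N) → (Var → Sv)` (`hrefl … hjunction`, verbatim), the cube count (`hQ`), and (2.49) [III] for `R.A'` against
`(1∕g_k²)·A^η_k` of record with the volume majorant and the log-term bounds (`hCA`, `hΓ`, `h249`, `hlog`, `hlog'` — [Balaban1988Convergent] Thm 2's output: the N11 → N13 Cor.-3 edge AT
THE RECORD).  The chain's sign binder `hA0 : 0 ≤ A^η_k(V)` is DISCHARGED: `Node00.wilsonBGOfRecord_nonneg` (a theorem of record).  Conclusion: (0.1) at every configuration with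
`E₋ = CA·c_Γ + c_L + πc·b`, `E₊ = CA·c_Γ + c_L′ + πc·b + M₁⁻⁴·K₀(64,8)·Σ_i e^{−c_i}`, `b = c₁e^{τc_v}K₀`.  CONDITIONAL on every input; nothing of Bałaban's asserted; count-neutral.
[cite: Balaban1989LargeFieldII, (0.1) p.356, (1.72) p.379, p.387 after (1.89), (1.98) p.390; Balaban1988Convergent, (2.49)–(2.50) p.264] -/
theorem uvIneq_at_record₁₀_of_gas (Nc : ℕ) [NeZero Nc] (R : Repr172 (GaugeField (F.P P.K) k (SU N)) (tsys 4 Nc).Dom)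
    {M₁ : ℝ} (hM : M₁ ≠ 0) (hnum : (Fintype.card (Site (F.P P.K) k) : ℝ) = (M₁ * Nc) ^ 4)
    {κ₁ : ℝ} (hκ : B12TreeDecay.kappa₀ (4 * 2 ^ 4) (2 * 4) ≤ κ₁) (c : Fin 2 → ℝ)
    (hH : R.Holds (densOfRecord₁₀ F N θ P k))
    (hχ01 : ∀ a V, 0 ≤ R.χ a V ∧ R.χ a V ≤ 1)
    (h0χ : ∀ V, R.χ R.allSmall V = chiFixed7 F N θ.ν P.K (gOfRecord₁₀ F N θ P) k V)
    (hZ : ∀ a V, (R.TZ a).T 1 V ≤ ∏ X ∈ R.Zc a, Real.exp (-(c 0) - κ₁ * (tsys 4 Nc).dj X))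
    (hY : ∀ a V, (R.TYs a).T 1 V ≤ ∏ Y ∈ R.Ys a, Real.exp (-(c 1) - κ₁ * (tsys 4 Nc).dj Y))
    {LF DomY Cube Var Sv : Type*} [Fintype LF] [Fintype DomY] [Fintype Cube] [DecidableEq LF] [DecidableEq DomY]
    [DecidableEq Cube] {adjC : Cube → Cube → Prop} [DecidableRel adjC]
    (hrefl : ∀ a, adjC a a) (hsymm : ∀ a b, adjC a b → adjC b a)
    {locX : LF → Finset Cube} {locY : DomY → Finset Cube} {site : Var → Cube} (Yfix : R.Adm → Finset Cube)
    (houtX : ∀ a j, (locX j \ Yfix a).Nonempty) (houtY : ∀ a Y, (locY Y \ Yfix a).Nonempty)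
    (Op : R.Adm → Finset LF → ((Var → Sv) → ℂ) →+ ((Var → Sv) → ℂ))
    (hOps : ∀ a, LocalOps adjC locX (Yfix a) site (Op a))
    (hOpReal : ∀ a (S : Finset LF) (f : (Var → Sv) → ℂ), (∀ ψ, (f ψ).im = 0) → ∀ φ, (Op a S f φ).im = 0)
    (Vt : R.Adm → DomY → (Var → Sv) → ℂ) (hV : ∀ a Y, DepOn (Yfix a) site (Vt a Y) (locY Y))
    (hVreal : ∀ a Y ψ, (Vt a Y ψ).im = 0) (cfg : GaugeField (F.P P.K) k (SU N) → (Var → Sv))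
    {nbr : Cube → Finset Cube} (hnbr : ∀ a b, adjC a b → a ∈ nbr b) {νn : ℝ} (hν : ∀ b, ((nbr b).card : ℝ) ≤ νn)
    {d : R.Adm → Finset Cube → ℝ} {c₁ Rr κ₀ K₀ cv τ : ℝ} (hd : ∀ a X, 0 ≤ d a X) (hc₁ : 0 ≤ c₁) (hK₀ : 0 ≤ K₀)
    (hτ : 0 ≤ τ)
    (h197 : ∀ a V X, ‖F191 adjC locX locY (Yfix a) (mayerTerm (Op a) (Vt a) (cfg V)) X‖ ≤ c₁ * Real.exp (-(Rr * d a X)))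
    (h126 : ∀ a, Ineq126 (polys190 adjC locX locY (Yfix a)) (fun X => X \ Yfix a) (d a) κ₀ K₀)
    (hvol : ∀ a, VolBound (polys190 adjC locX locY (Yfix a)) (fun X => X \ Yfix a) (d a) cv)
    (hrate : κ₀ + τ * cv ≤ Rr) (hsmall : c₁ * Real.exp (τ * cv) * K₀ * νn ≤ τ)
    (hjunction : ∀ a V, R.curly a V = (bracket (Op a) (Vt a) (cfg V)).re)
    {πc : ℝ} (hQ : (Fintype.card Cube : ℝ) ≤ πc * (Fintype.card (Site (F.P P.K) k) : ℝ))
    (logT : GaugeField (F.P P.K) k (SU N) → ℝ) {CA cΓ cL cL' : ℝ} {Γ : ℕ → ℝ} (hCA : 0 ≤ CA)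
    (hΓ : ∑ n ∈ Finset.Icc 1 k, Γ n ≤ cΓ * (Fintype.card (Site (F.P P.K) k) : ℝ))
    (h249 : ∀ V, Ineq249 (R.A' V) (1 / (gOfRecord₁₀ F N θ P k) ^ 2 * wilsonBGOfRecord F N θ.εbg P k V) (logT V) CA Γ k)
    (hlog : ∀ V, -(cL * (Fintype.card (Site (F.P P.K) k) : ℝ)) ≤ logT V)
    (hlog' : ∀ V, logT V ≤ cL' * (Fintype.card (Site (F.P P.K) k) : ℝ)) :
    ∀ V : GaugeField (F.P P.K) k (SU N),
      B16.UVIneq ((datumOfRecord₁₀ F N θ h).C P) k V (CA * cΓ + cL + πc * (c₁ * Real.exp (τ * cv) * K₀))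
        (CA * cΓ + cL' + πc * (c₁ * Real.exp (τ * cv) * K₀) +
          M₁⁻¹ ^ 4 * B12TreeDecay.K₀ (4 * 2 ^ 4) (2 * 4) * ∑ i, Real.exp (-(c i))) :=
  uvIneq_at_construction_of_gas F N (coreOfRecord₁₀ F N θ) (densOfRecord₁₀ F N θ) P k Nc R hM hnum hκ c hH hχ01 h0χ hZ hY
    hrefl hsymm Yfix houtX houtY Op hOps hOpReal Vt hV hVreal cfg hnbr hν hd hc₁ hK₀ hτ h197 h126 hvol hrate hsmall hjunction hQ
    logT hCA hΓ h249 hlog hlog' (fun V => wilsonBGOfRecord_nonneg F N θ.εbg P k V)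

end ChainAtRecord

/-! ## §5. N13 at a Stage-10 world from (R₁₀) + the chain's output IN ITS OWN LETTERS, dominated by the world's dependence functions (module 15 §2 re-keyed) -/

section Knit

variable (θ : Stage9Params F N) (w : WorldP) (P : B12.RunParams) (h : θ.Provisos₁₀)

/-- **N13 AT A STAGE-10 WORLD FROM (R₁₀) AND THE COR.-3 CHAIN'S OUTPUT IN ITS OWN LETTERS** ([Balaban1989LargeFieldII] Thm 1 p. 355 + (0.1), Cor. 3 pp. 387 ∕ 391, AT NODE 00's
Stage-10 objects): for `w.C = (datumOfRecord₁₀ F N θ h).C`, `w.up P = upOfRecord₅C F N (θ.toStage5₁₀ F N) P`, from — (R₁₀) `hR9` (law transport by 𝐑 along the tower of record; IS the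
leaf, module 14 §1); level-indexed constant families in the chain's letters `CA, cΓ, cL, cL′, πc, c₁, τ, cv, K₀, M₁ : ℕ → ℝ`, `c : ℕ → Fin 2 → ℝ` (the (2.49) constant and log-term
slopes, the cube-count ratio, the (1.97)∕Kotecký–Preiss constants, the cube side, the (1.79)∕(1.89) exponents); `huv`: below the threshold `γ₁ ≥ w.γ`, every §2-format level `k ≤ K`
satisfies (0.1) at every configuration with `E₋(k) = CA·cΓ + cL + πc·(c₁e^{τcv}K₀)`, `E₊(k) = E₋-shape with cL′ + M₁⁻⁴·K₀(64,8)·Σ_i e^{−c_i}` — EXACTLY the conclusion of §1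
`uvIneq_at_record₁₀_of_gas` at level `k` (so `huv` is supplied level by level from a (1.72) representation of `ρ_k` of record + the chain's leaves); `hdom`: DOMINATION
`E₋(k) ≤ w.em (g_k)`, `E₊(k) ≤ w.ep (g_k)` by the world's dependence functions of the coupling (p. 356 «E₋, E₊ independent of k, T_η, U_k» in the tree's reading: functions of
`g_k` alone).  = module 14 §3 `b16_main_at_record₁₀_dominated` with `Em := E₋(k)`, `Ep := E₊(k)`.  HYPOTHESES displayed; count-neutral; nothing of Bałaban's asserted.
[cite: Balaban1989LargeFieldII, Thm 1 p.355, (0.1) pp.355–356, p.387, p.391; Balaban1988Convergent, p.244, (2.49)–(2.50) p.264] -/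
theorem b16_main_at_record₁₀_of_chainLetters (hC : w.C = (datumOfRecord₁₀ F N θ h).C) (hup : w.up P = upOfRecord₅C F N (θ.toStage5₁₀ F N) P)
    (hR9 : ∀ k, k < P.K → TLaw₁₀ F N θ P k → SLaw₁₀ F N θ P (k + 1)) {γ₁ : ℝ} (hγ : w.γ ≤ γ₁)
    (CA cΓ cL cL' πc c₁ τ cv K₀ M₁ : ℕ → ℝ) (c : ℕ → Fin 2 → ℝ)
    (huv : (genFlow (betaOfRecord₁₀ F N θ) P.g0).InInterval γ₁ P.K → ∀ k, k ≤ P.K → SLaw₁₀ F N θ P k →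
      ∀ V : GaugeField (F.P P.K) k (SU N),
        B16.UVIneq ((datumOfRecord₁₀ F N θ h).C P) k V (CA k * cΓ k + cL k + πc k * (c₁ k * Real.exp (τ k * cv k) * K₀ k))
          (CA k * cΓ k + cL' k + πc k * (c₁ k * Real.exp (τ k * cv k) * K₀ k) +
            (M₁ k)⁻¹ ^ 4 * B12TreeDecay.K₀ (4 * 2 ^ 4) (2 * 4) * ∑ i, Real.exp (-(c k i))))
    (hdom : ∀ k, k ≤ P.K →
      CA k * cΓ k + cL k + πc k * (c₁ k * Real.exp (τ k * cv k) * K₀ k) ≤ w.em (gOfRecord₁₀ F N θ P k) ∧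
      CA k * cΓ k + cL' k + πc k * (c₁ k * Real.exp (τ k * cv k) * K₀ k) +
          (M₁ k)⁻¹ ^ 4 * B12TreeDecay.K₀ (4 * 2 ^ 4) (2 * 4) * ∑ i, Real.exp (-(c k i)) ≤ w.ep (gOfRecord₁₀ F N θ P k)) :
    Dag.B16_main (leavesP w P) :=
  b16_main_at_record₁₀_dominated F N θ w P h hC hup hR9 hγ fun hsc k hk hS =>
    ⟨_, _, (hdom k hk).1, (hdom k hk).2, huv hsc k hk hS⟩

end Knit

end Literature.MathematicalPhysics.QuantumFieldTheory.Balaban1983to89.B16NodeKnitRecord10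

end
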